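import Summits.BirchSwinnertonDyer.Rank1Residual.Partition.CornersFiveLeAfterClosures
import Summits.BirchSwinnertonDyer.Rank1Residual.X11b.ClassClosureWeightKChainLever
import Summits.BirchSwinnertonDyer.Rank1Residual.X11a.ChainBoundedHeightFree
import HarnessLib

/-!
# `p ≥ 5`, 'good ORDINARY, or MULTIPLICATIVE', analytic rank `≤ 1`, MODULO THE PER-PAIR
# CERTIFICATE BINDERS OF RECORD: the irreducible multiplicative classes X11a / X11b-without-(ram)
# shrink to their NON-SURJECTIVE image cells (and, for X11b, the split cells with `p` the only
# multiplicative prime) — cell `b2b-bsdres`, RESIDUAL-MAP.md §A / §C corner predicates; rmap-1 gen 9,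
# the gen's TWELFTH closing form (consumer of cc-typer-3's T-WK (b), p274916, and x11a's chain of
# record)

HONEST FRAMING (run/shared/lean/b2b/bsd-rank1-residual/, verbatim in every file): the goal of the
cell is to DELETE the COMBINATION-SHAPED residual classes of the Birch–Swinnerton-Dyer formula for
ALL analytic-rank `≤ 1` elliptic curves over `ℚ` — "full BSD formula for every rank `≤ 1` curve in
class `C`" assembled STRICTLY from published theorems — so that the rank-`≤ 1` remainder becomes
exactly the CONSTRUCTION-SHAPED classes, which are TYPED (missing-input `Prop`s), NOT attempted.
This is not "finishing BSD". Theorems only; NO definition, NO named fact introduced here; every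
published theorem enters as one of the tree's existing named Literature facts BY NAME; every
per-pair input is an explicit hypothesis asked ONLY on the cells that use it; nothing about any
particular curve is asserted; no label changes (X11a stays NEEDS X_C1, X11b stays NEEDS X_C2 /
CONSTRUCTION-SHAPED, X1 / X2 / X9 marks unchanged); nothing is booked by this file; census and
instrument rows (`μ^an(E,p) = 0`, a REGMULT height, a Riemann sum, the bit 'second multiplicative
prime') are EVIDENCE — their tier is referee A's and the lane's. The class-level statements behind
the per-pair binders are Greenberg's `μ`-conjecture and Schneider's conjecture (OPEN, NAMED, typed;
barrier `PAdicHeightNondegeneracy`), NEVER asserted here.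

## What this file records

`Partition/CornersFiveLeAfterClosures.lean` (p269647, the ELEVENTH form) leaves, at `p ≥ 5` on
'good ordinary ∨ multiplicative' in analytic rank `≤ 1`, the corner
`(X1 ∧ ¬gvpar) ∨ X11a ∨ (X2 ∧ ¬(r = 0 ∧ gvpar) ∧ ¬(r = 1 ∧ ¬split ∧ gvpar)) ∨ (X11b ∧ ¬Ram)`.
Two kernel chains of record act on the two IRREDUCIBLE multiplicative disjuncts when `ρ̄_{E,p}` is
onto, each modulo ONE per-pair certificate `μ^an(E,p) = 0` (`X11a.MuAnZeroAt W p`: the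
Néron-normalised Mazur–Tate–Teitelbaum series has a unit coefficient; instrument B-5 / iw census):
* x11a's chain of record `X11a.forall_bsdp_of_namedFacts_bdd_heightFree` — X11a ∩ {`p ≥ 5`, surj}:
  `BSD(E,p)` from fifteen named published facts + `MuAnZeroAt W p`;
* cc-typer-3's T-WK (b) `X11b.ClassClosure.bsdp_of_namedFacts_bdd_of_regulatorNonvanishing`
  (p274916) — X11b ∩ {`p ≥ 5`, surj}: `BSD(E,p)` from sixteen named published facts +
  `MuAnZeroAt W p` + `RegulatorNonvanishingAt W p` + (split `p`) a second multiplicative prime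
  (Disegni's (∗)). NOTE: `RegulatorNonvanishingAt W p` is BY DEFINITION the conjunction of the two
  multiplicative Schneider binders `hSchN ∧ hSchS` the ELEVENTH form already carries — so the lever
  costs NO new per-pair input beyond `μ^an = 0` and the census bit.
Substituting both:

* `bsdp_goodOrd_or_mult_of_five_le_rankLeOne_certificates` — **non-CM, `r ≤ 1`, `p ≥ 5`, good
  ordinary or multiplicative: `BSD(E,p)` unless
  `(X1 ∧ ¬gvpar) ∨ (X11a ∧ ¬surj) ∨ (X2 ∧ ¬(r = 0 ∧ gvpar) ∧ ¬(r = 1 ∧ ¬split ∧ gvpar)) ∨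
  (X11b ∧ ¬Ram ∧ (¬surj ∨ (split ∧ no second multiplicative prime)))`**, granted FORTY named facts
  (the thirty-one of the ELEVENTH form + Hida's congruent ordinary member, MTT weight `k`, EPW
  Thm 3.1.1 / Thm 1 / Thm 5.1.3 bounded, Wan Thm 4 rational bounded, Deligne–Serre 6.1, Hida 3.26,
  Kato–Wuthrich A32) and the per-pair hypotheses, each asked only where used: ONE bare Riemann-sum
  inequality on X1 ∧ gvpar (`hcert1`, the p274663 currency — no measure bound); Greenberg's `μ = 0`,
  the unit-coefficient certificate and the good-ordinary Schneider certificate on X9 (`hμ9`,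
  `hcert9`, `hSch9`); the two multiplicative Schneider binders (`hSchN`, `hSchS`; idle in rank 0);
  and `μ^an(E,p) = 0` on the surjective cells of X11a and of X11b-without-(ram) (`hμ11`);
* `bsdp_or_corner_goodOrd_or_mult_of_five_le_certificates` — the partition form.

So at `p ≥ 5` on both ordinary axes, modulo finite per-pair certificates of the kinds the lane's
instruments produce (Riemann sum; unit coefficient; `p`-adic height) and the two conjectures-in-print
applied AT THE PAIR (Greenberg `μ = 0` on X9; Schneider), the rank-`≤ 1` corner is FOUR DECIDABLE
image / reduction cells: type-A X1, non-surjective irreducible multiplicative image (both ranks), the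
two GV-parity sub-cells of X2, and the split X11b cells with `p` the only multiplicative prime
(where Disegni's (∗) fails; road: `RelativeExceptionalLeadingTermAt`, beyond print). No mark moves.

References: RESIDUAL-MAP.md §A / §C corner predicates and §I N1′ / N3 / N7 / N8 / N9;
`Partition/CornersFiveLeAfterClosures.lean` (p269647); `Partition/CornersRiemannSumCertificate.lean`
(p268319 + p274663); `X11b/ClassClosureWeightKChainLever.lean` (p274916);
`X11a/ChainBoundedHeightFree.lean`; [EmertonPollackWeston2006] Thm. 1, 3.1.1, 5.1.3;
[Wan2015] Thm. 4; [SteinWuthrich2013] Thm. 6.1, §4.2; [Disegni2020] Thm. 1, (∗);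
[GreenbergVatsal2000] Thm. (1.3); [Skinner2016PacificMC] Thm. C; referee A ROUND 199 / 201.
-/

noncomputable section

open scoped Classical MatrixGroups ModularForm NumberField

namespace Summit.BirchSwinnertonDyer.Rank1Residual

open CongruenceSubgroup WeierstrassCurve PowerSeries Literature.NumberTheory.EllipticCurves
  Literature.NumberTheory.EllipticCurves.Rank1Residual Literature.NumberTheory.EllipticCurves.ModularForms
  Literature.NumberTheory.EllipticCurves.Wuthrich2014
  Literature.NumberTheory.EllipticCurves.GreenbergVatsal2000
  Literature.NumberTheory.EllipticCurves.Rank1Residual.Typed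
  Literature.NumberTheory.EllipticCurves.Skinner2016
  Literature.NumberTheory.EllipticCurves.SteinWuthrich2013
  Literature.NumberTheory.EllipticCurves.Disegni2020
  Literature.NumberTheory.EllipticCurves.EmertonPollackWeston2006

section Curve

variable {W : WeierstrassCurve ℚ} [W.IsElliptic] [W.IsGloballyMinimal] {p : ℕ} [Fact p.Prime]

/-! ### The two surjective-image exits (pair level; pointers to the chains of record) -/

/-- **X11a, `p ≥ 5`, `ρ̄_{E,p}` onto, `μ^an(E,p) = 0` ⇒ `BSD(E,p)`** — x11a's chain of record
`X11a.forall_bsdp_of_namedFacts_bdd_heightFree` at the pair (fifteen named published facts + the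
per-pair certificate). Pointer theorem; CONDITIONAL; nothing booked; X11a's mark unchanged.
[cite: EmertonPollackWeston2006, Thm. 1, Thm. 3.1.1, Thm. 5.1.3, §3.1] [cite: Wan2015, Thm. 4]
[cite: SteinWuthrich2013, Thm. 6.1 (p. 20)] -/
theorem bsdp_of_classX11a_of_surj_of_muAnZeroAt
    (hHida : hida_exists_congruent_ordinary_newform_of_multiplicative)
    (hMTT : exists_isCycPAdicLFunctionWeightK)
    (h311e : thm311_cotorsion_weightK_member) (hT1a : thm1_muAlg_of_weightK_member)
    (hT2 : Wan2015.thm4_rational_weightK_member_of_bdd)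
    (hT1b : thm513_transfer_from_weightK_member_of_bdd)
    (h61 : DeligneSerre1974.thm61_exists_adicGaloisRep) (h326 : Hida2000_thm326_ordinary)
    (hKato : kato_charIdeal_dvd_multiplicative_of_surjective)
    (hJs : thm61_splitMultiplicative) (hJn : thm61_nonsplitMultiplicative)
    (hGZK : rank_eq_analyticRank_of_analyticRank_le_one) (hmod : hasEntireLFunction_rat)
    (hmodP : nonempty_modularParametrizationData)
    (hGS : ∀ (W : WeierstrassCurve ℚ) [W.IsElliptic] [W.IsGloballyMinimal] (p : ℕ) [Fact p.Prime],
      greenberg_stevens (W := W) (p := p))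
    (hX : ClassX11a W p) (h5 : 5 ≤ p) (hsurj : Surj W p) (hμ : X11a.MuAnZeroAt W p) : BSDp W p :=
  X11a.forall_bsdp_of_namedFacts_bdd_heightFree hHida hMTT h311e hT1a hT2 hT1b h61 h326 hKato hJs
    hJn hGZK hmod hmodP hGS W p hX h5 hsurj hμ

/-- **X11b, `p ≥ 5`, `ρ̄_{E,p}` onto, `μ^an(E,p) = 0`, the two multiplicative Schneider binders, and
(split `p`) a second multiplicative prime ⇒ `BSD(E,p)`** — cc-typer-3's T-WK (b)
`X11b.ClassClosure.bsdp_of_namedFacts_bdd_of_regulatorNonvanishing` (p274916) with its regulator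
input `RegulatorNonvanishingAt W p` ASSEMBLED from the two Schneider binders `hSchN` / `hSchS` of the
Partition corner files (it is their conjunction by definition). (ram) is NOT needed. Pointer theorem;
CONDITIONAL; nothing booked; X11b stays CONSTRUCTION-SHAPED.
[cite: EmertonPollackWeston2006, Thm. 1, Thm. 3.1.1, Thm. 5.1.3, §3.1] [cite: Wan2015, Thm. 4]
[cite: SteinWuthrich2013, Thm. 6.1 (p. 20), §4.2] [cite: Disegni2020, Thm. 1 (§1.2), hypothesis (∗)] -/
theorem bsdp_of_classX11b_of_surj_of_muAnZeroAt_of_schneider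
    (hHida : hida_exists_congruent_ordinary_newform_of_multiplicative)
    (hMTT : exists_isCycPAdicLFunctionWeightK)
    (h311e : thm311_cotorsion_weightK_member) (hT1a : thm1_muAlg_of_weightK_member)
    (hT2 : Wan2015.thm4_rational_weightK_member_of_bdd)
    (hT1b : thm513_transfer_from_weightK_member_of_bdd)
    (h61 : DeligneSerre1974.thm61_exists_adicGaloisRep) (h326 : Hida2000_thm326_ordinary)
    (hKato : kato_charIdeal_dvd_multiplicative_of_surjective)
    (hJn : thm61_nonsplitMultiplicative) (hJs : thm61_splitMultiplicative)
    (hHn : exists_isMultCanonical) (hHs : exists_isSplitMultCanonical)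
    (hD : thm1_padicBSD_rankOne_multiplicative)
    (hGZK : rank_eq_analyticRank_of_analyticRank_le_one)
    (hmodP : nonempty_modularParametrizationData) (hX : ClassX11b W p) (h5 : 5 ≤ p) (hsurj : Surj W p) (hμ : X11a.MuAnZeroAt W p)
    (hm : W.HasSplitMultiplicativeReductionAtPrime p →
      ∃ (m : ℕ) (_ : Fact m.Prime), m ≠ p ∧ W.HasMultiplicativeReductionAtPrime m)
    (hSchN : ∀ (q : ℚ_[p]) (Dh : PAdicHeightData W p), q ≠ 0 → ‖q‖ < 1 → tateJ q = (W.j : ℚ_[p]) →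
      IsMultCanonical Dh q → SchneiderConjecture Dh)
    (hSchS : ∀ (Dq : TateParameterData W p) (Dh : PAdicHeightData W p),
      IsSplitMultCanonical Dh Dq → SchneiderConjecture Dh) : BSDp W p :=
  X11b.ClassClosure.bsdp_of_namedFacts_bdd_of_regulatorNonvanishing W p hHida hMTT h311e hT1a hT2
    hT1b h61 h326 hKato hJn hJs hHn hHs hD hGZK hmodP hX h5 hsurj hμ hm ⟨hSchN, hSchS⟩

/-! ### The TWELFTH closing form -/

/-- **Non-CM, `p ≥ 5`, 'good ORDINARY, or MULTIPLICATIVE', analytic rank `≤ 1`, modulo the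
per-pair certificate binders of record: FORTY named facts.** `BSD(E,p)` unless `(E,p)` lies in
`X1 ∧ ¬gvpar` (type A), in X11a with NON-surjective `ρ̄_{E,p}`, in X2 outside both its rank-`0`
GV-parity sub-cell and its rank-`1` non-split GV-parity sub-cell, or in X11b without a (ram)
witness and with either non-surjective `ρ̄_{E,p}` or split reduction at `p` and no second
multiplicative prime — granted, each only where used: ONE bare Riemann-sum inequality for a newform
on X1 ∧ gvpar (`hcert1`); Greenberg's `μ = 0`, the unit-coefficient certificate and the
good-ordinary Schneider certificate on X9 (`hμ9`, `hcert9`, `hSch9`); the two multiplicative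
Schneider binders (`hSchN`, `hSchS`); `μ^an(E,p) = 0` on the surjective cells of X11a and of
X11b-without-(ram) (`hμ11`). Good ordinary: `CornersRiemannSumCertificate` (Lt form) outside X9,
`CornersGreenbergMu` on X9; multiplicative: the two exits above, then
`CornersMultTargetA.bsdp_mult_of_schneider_sharp_of_derivedFacts`. [folklore] -/
theorem bsdp_goodOrd_or_mult_of_five_le_rankLeOne_certificates
    (hBCS : BurungaleCastellaSkinner2025.cor131_padicValRat_bsd_rank_le_one)
    (hBCSa : burungale_castella_skinner_charIdeal_eq_padicLFunction)
    (hGZK : rank_eq_analyticRank_of_analyticRank_le_one)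
    (hCGS : CastellaGrossiSkinner2025.thmD_padicValRat_bsd_rank_le_one)
    (hGVg : GreenbergVatsal2000.thm13_charIdeal_eq_of_gvPar) (hGr : greenberg_charValue_rankZero)
    (hmod : hasEntireLFunction_rat) (hmodP : nonempty_modularParametrizationData)
    (hS : Schneider1985_order_charGenerator) (hPR : perrinRiou_rankOne_leadingTerms)
    (hΩ : realPeriodRat_eq_unit_mul_plusPeriod)
    (hSk : Skinner2016.thmC_padicValRat_bsd_rank_zero) (hA : thmA_charIdeal_multiplicative)
    (hD : thm1_padicBSD_rankOne_multiplicative)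
    (hT : Silverman1994_thmV53_tateUniformisation.{0})
    (hT' : Silverman1994_thmV53_corV54_tateUniformisation.{0})
    (hΛ : lambda_nonPrimitive_eq_add_sum_delta_multiplicative)
    (hB : datumSelmer_divisible_of_finite_torsionBy)
    (hF : datumStrictSelmer_lt_datumSelmer_of_split)
    (hLiftF : residualEpsilon_surjOn_of_lineRamifiedEven)
    (hP : cor38_realPeriodRat_eq_unit_mul_of_isIsogenous_of_gvPar)
    (hEx : exists_characterLFunction)
    (h311 : thm311_hasUnitContent_iff_and_order_eq_of_lineRamifiedEven)
    (hLC : characterLFunctionC_hasUnitContent_and_order_eq_card)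
    (hLD : characterLFunctionD_hasUnitContent_and_order_eq_card)
    (hWu : thm16_charIdeal_dvd_multiplicative_of_reducible)
    (hJs : thm61_splitMultiplicative) (hJn : thm61_nonsplitMultiplicative)
    (hHs : exists_isSplitMultCanonical) (hHn : exists_isMultCanonical)
    (hGS : ∀ (W : WeierstrassCurve ℚ) [W.IsElliptic] [W.IsGloballyMinimal] (p : ℕ) [Fact p.Prime],
      greenberg_stevens (W := W) (p := p))
    (hHida : hida_exists_congruent_ordinary_newform_of_multiplicative)
    (hMTT : exists_isCycPAdicLFunctionWeightK)
    (h311e : thm311_cotorsion_weightK_member) (hT1a : thm1_muAlg_of_weightK_member)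
    (hT2 : Wan2015.thm4_rational_weightK_member_of_bdd)
    (hT1b : thm513_transfer_from_weightK_member_of_bdd)
    (h61 : DeligneSerre1974.thm61_exists_adicGaloisRep) (h326 : Hida2000_thm326_ordinary)
    (hKato : kato_charIdeal_dvd_multiplicative_of_surjective)
    (hcm : ¬ W.HasCM) (hr : W.analyticRank ≤ 1) (h5 : 5 ≤ p) (hdom : GoodOrd W p ∨ Mult W p)
    (hcert1 : ClassX1 W p → GVPar W p →
      ∃ (N : ℕ) (_ : NeZero N) (f : CuspForm (Gamma0 N) 2), IsNewformOf W f ∧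
        ∃ n : ℕ, (p : ℝ) ^ (-n : ℤ) < ‖padicLRiemannSum f (unitRoot W p : ℚ_[p]) 1 n‖)
    (hμ9 : ClassX9 W p → ∀ (κ : ZpExtension ℚ p) (γ : Field.absoluteGaloisGroup ℚ),
        κ.IsCyclotomic → κ.IsTopGenerator γ → IsCyclotomicVariable p γ →
      ∀ (D : W.SelmerDualData κ γ), D.mu = 0)
    (hcert9 : ClassX9 W p → ∀ [NeZero (W.conductorNorm ℤ)]
        (f : CuspForm (CongruenceSubgroup.Gamma0 (W.conductorNorm ℤ)) 2),
        IsNewformOf W f → ∀ (ϖ : ℚ), (ϖ : ℝ) * W.realPeriodRat = plusPeriod f →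
      ∃ n : ℕ, ‖PowerSeries.coeff n
        (PowerSeries.C (ϖ : ℚ_[p]) * padicLFunction f (unitRoot W p : ℚ_[p]))‖ = 1)
    (hSch9 : ClassX9 W p → ∀ Dh : PAdicHeightData W p, Dh.IsCanonical → SchneiderConjecture Dh)
    (hSchN : ∀ (q : ℚ_[p]) (Dh : PAdicHeightData W p), q ≠ 0 → ‖q‖ < 1 → tateJ q = (W.j : ℚ_[p]) →
      IsMultCanonical Dh q → SchneiderConjecture Dh)
    (hSchS : ∀ (Dq : TateParameterData W p) (Dh : PAdicHeightData W p),
      IsSplitMultCanonical Dh Dq → SchneiderConjecture Dh)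
    (hμ11 : ClassX11a W p ∨ (ClassX11b W p ∧ ¬ Ram W p) → Surj W p → X11a.MuAnZeroAt W p)
    (hA1 : ¬ (ClassX1 W p ∧ ¬ GVPar W p)) (hX11a : ¬ (ClassX11a W p ∧ ¬ Surj W p))
    (hX2 : ¬ (ClassX2 W p ∧ ¬ (W.analyticRank = 0 ∧ GVPar W p) ∧
      ¬ (W.analyticRank = 1 ∧ ¬ W.HasSplitMultiplicativeReductionAtPrime p ∧ GVPar W p)))
    (hX11b : ¬ (ClassX11b W p ∧ ¬ Ram W p ∧ (¬ Surj W p ∨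
      (W.HasSplitMultiplicativeReductionAtPrime p ∧
        ¬ ∃ (m : ℕ) (_ : Fact m.Prime), m ≠ p ∧ W.HasMultiplicativeReductionAtPrime m)))) :
    BSDp W p := by
  rcases hdom with hgo | hm
  · by_cases hX9 : ClassX9 W p
    · haveI : NeZero (W.conductorNorm ℤ) := ⟨(W.conductorNorm_pos_holds).ne'⟩
      exact bsdp_of_classX9_of_greenbergMu_of_schneider hBCSa hGr hΩ hS hPR hmodP hmod hGZK hr hX9
        (hμ9 hX9) (fun f hf ϖ hϖ => hcert9 hX9 f hf ϖ hϖ) (hSch9 hX9)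
    · exact bsdp_goodOrd_of_five_le_of_riemannSumLt_sharp hBCS hGZK hCGS hGVg hGr hmod hmodP hS hPR
        hcm hr hgo h5 hcert1 hA1 hX9
  · by_cases hXa : ClassX11a W p
    · have hsurj : Surj W p := by
        by_contra hns
        exact hX11a ⟨hXa, hns⟩
      exact bsdp_of_classX11a_of_surj_of_muAnZeroAt hHida hMTT h311e hT1a hT2 hT1b h61 h326 hKato
        hJs hJn hGZK hmod hmodP hGS hXa h5 hsurj (hμ11 (Or.inl hXa) hsurj)
    · by_cases hXb : ClassX11b W p ∧ ¬ Ram W p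
      · have hsurj : Surj W p := by
          by_contra hns
          exact hX11b ⟨hXb.1, hXb.2, Or.inl hns⟩
        have hsec : W.HasSplitMultiplicativeReductionAtPrime p →
            ∃ (m : ℕ) (_ : Fact m.Prime), m ≠ p ∧ W.HasMultiplicativeReductionAtPrime m := by
          intro hsplit
          by_contra hno
          exact hX11b ⟨hXb.1, hXb.2, Or.inr ⟨hsplit, hno⟩⟩
        exact bsdp_of_classX11b_of_surj_of_muAnZeroAt_of_schneider hHida hMTT h311e hT1a hT2 hT1b
          h61 h326 hKato hJn hJs hHn hHs hD hGZK hmodP hXb.1 h5 hsurj (hμ11 (Or.inr hXb) hsurj)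
          hsec hSchN hSchS
      · refine bsdp_mult_of_schneider_sharp_of_derivedFacts hSk hA hD hT hT' hΛ hB hF hLiftF hP hEx
          h311 hLC hLD hWu hJs hJn hHs hHn hGZK hmod hmodP hGS (by omega) hm hr hSchN hSchS hXa
          hX2 ?_
        rintro ⟨hX, hnot⟩
        by_cases hram : Ram W p
        · exact hnot ⟨hram, fun _ => h5⟩
        · exact hXb ⟨hX, hram⟩

/-- **Partition form, `p ≥ 5`, 'good ORDINARY, or MULTIPLICATIVE', rank `≤ 1`, modulo the
per-pair certificate binders of record:
`BSD(E,p) ∨ (X1 ∧ ¬gvpar) ∨ (X11a ∧ ¬surj) ∨ (X2 ∧ ¬(r = 0 ∧ gvpar) ∧ ¬(r = 1 ∧ ¬split ∧ gvpar))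
∨ (X11b ∧ ¬Ram ∧ (¬surj ∨ (split ∧ no second multiplicative prime)))`** from the same forty named
facts and per-pair hypotheses. [folklore] -/
theorem bsdp_or_corner_goodOrd_or_mult_of_five_le_certificates
    (hBCS : BurungaleCastellaSkinner2025.cor131_padicValRat_bsd_rank_le_one)
    (hBCSa : burungale_castella_skinner_charIdeal_eq_padicLFunction)
    (hGZK : rank_eq_analyticRank_of_analyticRank_le_one)
    (hCGS : CastellaGrossiSkinner2025.thmD_padicValRat_bsd_rank_le_one)
    (hGVg : GreenbergVatsal2000.thm13_charIdeal_eq_of_gvPar) (hGr : greenberg_charValue_rankZero)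
    (hmod : hasEntireLFunction_rat) (hmodP : nonempty_modularParametrizationData)
    (hS : Schneider1985_order_charGenerator) (hPR : perrinRiou_rankOne_leadingTerms)
    (hΩ : realPeriodRat_eq_unit_mul_plusPeriod)
    (hSk : Skinner2016.thmC_padicValRat_bsd_rank_zero) (hA : thmA_charIdeal_multiplicative)
    (hD : thm1_padicBSD_rankOne_multiplicative)
    (hT : Silverman1994_thmV53_tateUniformisation.{0})
    (hT' : Silverman1994_thmV53_corV54_tateUniformisation.{0})
    (hΛ : lambda_nonPrimitive_eq_add_sum_delta_multiplicative)
    (hB : datumSelmer_divisible_of_finite_torsionBy)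
    (hF : datumStrictSelmer_lt_datumSelmer_of_split)
    (hLiftF : residualEpsilon_surjOn_of_lineRamifiedEven)
    (hP : cor38_realPeriodRat_eq_unit_mul_of_isIsogenous_of_gvPar)
    (hEx : exists_characterLFunction)
    (h311 : thm311_hasUnitContent_iff_and_order_eq_of_lineRamifiedEven)
    (hLC : characterLFunctionC_hasUnitContent_and_order_eq_card)
    (hLD : characterLFunctionD_hasUnitContent_and_order_eq_card)
    (hWu : thm16_charIdeal_dvd_multiplicative_of_reducible)
    (hJs : thm61_splitMultiplicative) (hJn : thm61_nonsplitMultiplicative)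
    (hHs : exists_isSplitMultCanonical) (hHn : exists_isMultCanonical)
    (hGS : ∀ (W : WeierstrassCurve ℚ) [W.IsElliptic] [W.IsGloballyMinimal] (p : ℕ) [Fact p.Prime],
      greenberg_stevens (W := W) (p := p))
    (hHida : hida_exists_congruent_ordinary_newform_of_multiplicative)
    (hMTT : exists_isCycPAdicLFunctionWeightK)
    (h311e : thm311_cotorsion_weightK_member) (hT1a : thm1_muAlg_of_weightK_member)
    (hT2 : Wan2015.thm4_rational_weightK_member_of_bdd)
    (hT1b : thm513_transfer_from_weightK_member_of_bdd)
    (h61 : DeligneSerre1974.thm61_exists_adicGaloisRep) (h326 : Hida2000_thm326_ordinary)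
    (hKato : kato_charIdeal_dvd_multiplicative_of_surjective)
    (hcm : ¬ W.HasCM) (hr : W.analyticRank ≤ 1) (h5 : 5 ≤ p) (hdom : GoodOrd W p ∨ Mult W p)
    (hcert1 : ClassX1 W p → GVPar W p →
      ∃ (N : ℕ) (_ : NeZero N) (f : CuspForm (Gamma0 N) 2), IsNewformOf W f ∧
        ∃ n : ℕ, (p : ℝ) ^ (-n : ℤ) < ‖padicLRiemannSum f (unitRoot W p : ℚ_[p]) 1 n‖)
    (hμ9 : ClassX9 W p → ∀ (κ : ZpExtension ℚ p) (γ : Field.absoluteGaloisGroup ℚ),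
        κ.IsCyclotomic → κ.IsTopGenerator γ → IsCyclotomicVariable p γ →
      ∀ (D : W.SelmerDualData κ γ), D.mu = 0)
    (hcert9 : ClassX9 W p → ∀ [NeZero (W.conductorNorm ℤ)]
        (f : CuspForm (CongruenceSubgroup.Gamma0 (W.conductorNorm ℤ)) 2),
        IsNewformOf W f → ∀ (ϖ : ℚ), (ϖ : ℝ) * W.realPeriodRat = plusPeriod f →
      ∃ n : ℕ, ‖PowerSeries.coeff n
        (PowerSeries.C (ϖ : ℚ_[p]) * padicLFunction f (unitRoot W p : ℚ_[p]))‖ = 1)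
    (hSch9 : ClassX9 W p → ∀ Dh : PAdicHeightData W p, Dh.IsCanonical → SchneiderConjecture Dh)
    (hSchN : ∀ (q : ℚ_[p]) (Dh : PAdicHeightData W p), q ≠ 0 → ‖q‖ < 1 → tateJ q = (W.j : ℚ_[p]) →
      IsMultCanonical Dh q → SchneiderConjecture Dh)
    (hSchS : ∀ (Dq : TateParameterData W p) (Dh : PAdicHeightData W p),
      IsSplitMultCanonical Dh Dq → SchneiderConjecture Dh)
    (hμ11 : ClassX11a W p ∨ (ClassX11b W p ∧ ¬ Ram W p) → Surj W p → X11a.MuAnZeroAt W p) :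
    BSDp W p ∨ (ClassX1 W p ∧ ¬ GVPar W p) ∨ (ClassX11a W p ∧ ¬ Surj W p) ∨
      (ClassX2 W p ∧ ¬ (W.analyticRank = 0 ∧ GVPar W p) ∧
        ¬ (W.analyticRank = 1 ∧ ¬ W.HasSplitMultiplicativeReductionAtPrime p ∧ GVPar W p)) ∨
      (ClassX11b W p ∧ ¬ Ram W p ∧ (¬ Surj W p ∨
        (W.HasSplitMultiplicativeReductionAtPrime p ∧
          ¬ ∃ (m : ℕ) (_ : Fact m.Prime), m ≠ p ∧ W.HasMultiplicativeReductionAtPrime m))) := by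
  by_cases hA1 : ClassX1 W p ∧ ¬ GVPar W p
  · exact Or.inr (Or.inl hA1)
  by_cases hX11a : ClassX11a W p ∧ ¬ Surj W p
  · exact Or.inr (Or.inr (Or.inl hX11a))
  by_cases hX2 : ClassX2 W p ∧ ¬ (W.analyticRank = 0 ∧ GVPar W p) ∧
      ¬ (W.analyticRank = 1 ∧ ¬ W.HasSplitMultiplicativeReductionAtPrime p ∧ GVPar W p)
  · exact Or.inr (Or.inr (Or.inr (Or.inl hX2)))
  by_cases hX11b : ClassX11b W p ∧ ¬ Ram W p ∧ (¬ Surj W p ∨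
      (W.HasSplitMultiplicativeReductionAtPrime p ∧
        ¬ ∃ (m : ℕ) (_ : Fact m.Prime), m ≠ p ∧ W.HasMultiplicativeReductionAtPrime m))
  · exact Or.inr (Or.inr (Or.inr (Or.inr hX11b)))
  exact Or.inl (bsdp_goodOrd_or_mult_of_five_le_rankLeOne_certificates hBCS hBCSa hGZK hCGS hGVg hGr
    hmod hmodP hS hPR hΩ hSk hA hD hT hT' hΛ hB hF hLiftF hP hEx h311 hLC hLD hWu hJs hJn hHs hHn
    hGS hHida hMTT h311e hT1a hT2 hT1b h61 h326 hKato hcm hr h5 hdom hcert1 hμ9 hcert9 hSch9 hSchN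
    hSchS hμ11 hA1 hX11a hX2 hX11b)

end Curve

end Summit.BirchSwinnertonDyer.Rank1Residual
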